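import Mathlib

/-!
# ValiantsHypothesis / RigidityForcesSymmetry — crux `LaplaceOptimalFive` (stmt-ValiantsHypothesis-24813), crux idea
`young-shadow` (K1) on the star: **THE WEDGE IDENTITIES OF A CLOSED TWO-TERM SHADOW** (memo §11/§14, entry of LEMMA K)

Letter-tensor currency (✓ `LaplaceFiveStar.rankOne_closed`, ✓ `star_shadow_exchange`).  A two-term shadow `H = U₁⊗W₁ + U₂⊗W₂`
(`U_i` symmetric quadrics = short factors, `W_i` symmetric cubics = long factors) is CLOSED when the 8-term exchange identity `(C_H)` holds
(✓ `star_shadow_exchange` supplies it for every star shadow).  In vector form (`y : Fin 5 → ℂ`, `P_i := U_i y`, `K_i := W_i(y,y,·)`),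
`(C_H)` is the polarisation of the 2-form identity `Σ_i dq_i ∧ dk_i = 0` (memo §11):

* `wedge_two_form`:  `Σ_i (P_i(a) K_i(c) − P_i(c) K_i(a)) = 0` for all `y, a, c` (sums written out);
* `wedge_minors`:    every `3 × 3` minor of the `5 × 3` matrix `[K₁ | P₁ | P₂]` vanishes, i.e. `dk₁ ∧ dq₁ ∧ dq₂ = 0` pointwise —
  the hypothesis of the referee's LEMMA K (`NOTE-crit3g5-24813-Lemma2prime-elementary.md` §B), from which LEMMA 2′ follows.

Pure finite algebra over `ℂ` (reindexing of triple sums + `linear_combination`); no star hypotheses, no definitions, no `sorry`.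
Honest framing: helper toward the Lean price (L2); K1 on the star is a PAPER theorem (referee PASS), not kernel; `LaplaceOptimalFive`
OPEN · CONTESTED 72/120; `VP ≠ VNP` NOT proved.
-/

set_option linter.dupNamespace false

namespace Summit.ValiantsHypothesis.ValiantsHypothesis.Theorems.RigidityForcesSymmetryRankRigidMinimalRepr

namespace LaplaceFiveStar

open Finset

/-- **Vector form of closedness** for a two-term letter tensor: `(C_H)` ⟹ `Σ_i (U_i y)_a · W_i(c,y,y) = Σ_i (U_i y)_c · W_i(a,y,y)`
(written with the triple sum expanded). [folklore] -/
theorem wedge_two_form (U₁ U₂ : Fin 5 → Fin 5 → ℂ) (W₁ W₂ : Fin 5 → Fin 5 → Fin 5 → ℂ)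
    (hW1 : ∀ a b c : Fin 5, W₁ a b c = W₁ a c b) (hW2 : ∀ a b c : Fin 5, W₂ a b c = W₂ a c b)
    (hC : ∀ A B C D E : Fin 5,
      (U₁ A C * W₁ B D E + U₁ A D * W₁ B C E + U₁ A E * W₁ B C D)
        + (U₂ A C * W₂ B D E + U₂ A D * W₂ B C E + U₂ A E * W₂ B C D)
      = (U₁ B C * W₁ A D E + U₁ B D * W₁ A C E + U₁ B E * W₁ A C D)
        + (U₂ B C * W₂ A D E + U₂ B D * W₂ A C E + U₂ B E * W₂ A C D))
    (y : Fin 5 → ℂ) (a c : Fin 5) :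
    ∑ d : Fin 5, ∑ e : Fin 5, ∑ f : Fin 5, y d * y e * y f *
      ((U₁ a d * W₁ c e f + U₂ a d * W₂ c e f) - (U₁ c d * W₁ a e f + U₂ c d * W₂ a e f)) = 0 := by
  -- Φ d e f := the summand's bracket; the three cyclic re-indexings of the sum agree
  set Φ : Fin 5 → Fin 5 → Fin 5 → ℂ := fun d e f =>
    (U₁ a d * W₁ c e f + U₂ a d * W₂ c e f) - (U₁ c d * W₁ a e f + U₂ c d * W₂ a e f) with hΦ
  set S : ℂ := ∑ d : Fin 5, ∑ e : Fin 5, ∑ f : Fin 5, y d * y e * y f * Φ d e f with hS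
  have s2 : S = ∑ d : Fin 5, ∑ e : Fin 5, ∑ f : Fin 5, y d * y e * y f * Φ f d e := by
    rw [hS, Finset.sum_comm]
    refine Finset.sum_congr rfl fun e _ => ?_
    rw [Finset.sum_comm]
    refine Finset.sum_congr rfl fun f _ => Finset.sum_congr rfl fun d _ => ?_
    ring
  have s3 : S = ∑ d : Fin 5, ∑ e : Fin 5, ∑ f : Fin 5, y d * y e * y f * Φ e f d := by
    rw [hS]
    rw [show (∑ d : Fin 5, ∑ e : Fin 5, ∑ f : Fin 5, y d * y e * y f * Φ d e f)
        = ∑ d : Fin 5, ∑ f : Fin 5, ∑ e : Fin 5, y d * y e * y f * Φ d e f from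
        Finset.sum_congr rfl fun d _ => Finset.sum_comm]
    rw [Finset.sum_comm]
    refine Finset.sum_congr rfl fun f _ => Finset.sum_congr rfl fun d _ => Finset.sum_congr rfl fun e _ => ?_
    ring
  -- pointwise: Φ d e f + Φ e f d + Φ f d e = 0 by (C_H) at (a, c, d, e, f) and the symmetry of W
  have key : ∀ d e f : Fin 5, Φ d e f + Φ e f d + Φ f d e = 0 := by
    intro d e f
    have h := hC a c d e f
    simp only [hΦ]
    have e1 : W₁ c f d = W₁ c d f := by rw [hW1 c f d]
    have e2 : W₂ c f d = W₂ c d f := by rw [hW2 c f d]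
    have e3 : W₁ a f d = W₁ a d f := by rw [hW1 a f d]
    have e4 : W₂ a f d = W₂ a d f := by rw [hW2 a f d]
    rw [e1, e2, e3, e4]
    linear_combination h
  have h3 : 3 * S = 0 := by
    have : 3 * S = S + S + S := by ring
    rw [this]
    nth_rewrite 2 [s3]
    nth_rewrite 2 [s2]
    rw [← Finset.sum_add_distrib, ← Finset.sum_add_distrib]
    refine Finset.sum_eq_zero fun d _ => ?_
    rw [← Finset.sum_add_distrib, ← Finset.sum_add_distrib]
    refine Finset.sum_eq_zero fun e _ => ?_
    rw [← Finset.sum_add_distrib, ← Finset.sum_add_distrib]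
    refine Finset.sum_eq_zero fun f _ => ?_
    have := key d e f
    linear_combination (y d * y e * y f) * this
  have : S = 0 := by
    have h := h3
    linear_combination h / 3
  simpa [hS, hΦ] using this

/-- **Wedge with `dq₂`: the `3 × 3` minors of `[K₁ | P₁ | P₂]` vanish** (`dk₁ ∧ dq₁ ∧ dq₂ = 0` pointwise), where
`P_i(a) = Σ_d U_i a d · y d` and `K_i(a) = Σ_{e,f} W_i a e f · y e · y f`.  Input: the vector form of closedness at the three index
pairs `(a,b), (a,c), (b,c)`. [folklore] -/
theorem wedge_minors (P₁ P₂ K₁ K₂ : Fin 5 → ℂ)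
    (hv : ∀ a c : Fin 5, P₁ a * K₁ c + P₂ a * K₂ c = P₁ c * K₁ a + P₂ c * K₂ a) (a b c : Fin 5) :
    K₁ a * (P₁ b * P₂ c - P₁ c * P₂ b) - K₁ b * (P₁ a * P₂ c - P₁ c * P₂ a)
      + K₁ c * (P₁ a * P₂ b - P₁ b * P₂ a) = 0 := by
  have h1 := hv b c
  have h2 := hv a c
  have h3 := hv a b
  linear_combination P₂ b * h2 - P₂ a * h1 - P₂ c * h3

/-- The same minors with the sums written out, directly from `(C_H)` (combine `wedge_two_form` and `wedge_minors`). [folklore] -/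
theorem wedge_minors_of_exchange (U₁ U₂ : Fin 5 → Fin 5 → ℂ) (W₁ W₂ : Fin 5 → Fin 5 → Fin 5 → ℂ)
    (hW1 : ∀ a b c : Fin 5, W₁ a b c = W₁ a c b) (hW2 : ∀ a b c : Fin 5, W₂ a b c = W₂ a c b)
    (hC : ∀ A B C D E : Fin 5,
      (U₁ A C * W₁ B D E + U₁ A D * W₁ B C E + U₁ A E * W₁ B C D)
        + (U₂ A C * W₂ B D E + U₂ A D * W₂ B C E + U₂ A E * W₂ B C D)
      = (U₁ B C * W₁ A D E + U₁ B D * W₁ A C E + U₁ B E * W₁ A C D)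
        + (U₂ B C * W₂ A D E + U₂ B D * W₂ A C E + U₂ B E * W₂ A C D))
    (y : Fin 5 → ℂ) (a b c : Fin 5) :
    let P₁ : Fin 5 → ℂ := fun x => ∑ d : Fin 5, U₁ x d * y d
    let P₂ : Fin 5 → ℂ := fun x => ∑ d : Fin 5, U₂ x d * y d
    let K₁ : Fin 5 → ℂ := fun x => ∑ e : Fin 5, ∑ f : Fin 5, W₁ x e f * y e * y f
    K₁ a * (P₁ b * P₂ c - P₁ c * P₂ b) - K₁ b * (P₁ a * P₂ c - P₁ c * P₂ a)
      + K₁ c * (P₁ a * P₂ b - P₁ b * P₂ a) = 0 := by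
  intro P₁ P₂ K₁
  set K₂ : Fin 5 → ℂ := fun x => ∑ e : Fin 5, ∑ f : Fin 5, W₂ x e f * y e * y f with hK₂
  refine wedge_minors P₁ P₂ K₁ K₂ (fun p q => ?_) a b c
  -- vector form at (p, q): expand the products into the triple sum of `wedge_two_form`
  have h := wedge_two_form U₁ U₂ W₁ W₂ hW1 hW2 hC y p q
  have expand : ∀ (U : Fin 5 → Fin 5 → ℂ) (W : Fin 5 → Fin 5 → Fin 5 → ℂ) (s t : Fin 5),
      (∑ d : Fin 5, U s d * y d) * (∑ e : Fin 5, ∑ f : Fin 5, W t e f * y e * y f)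
        = ∑ d : Fin 5, ∑ e : Fin 5, ∑ f : Fin 5, y d * y e * y f * (U s d * W t e f) := by
    intro U W s t
    rw [Finset.sum_mul]
    refine Finset.sum_congr rfl fun d _ => ?_
    rw [Finset.mul_sum]
    refine Finset.sum_congr rfl fun e _ => ?_
    rw [Finset.mul_sum]
    refine Finset.sum_congr rfl fun f _ => ?_
    ring
  have eP1 : P₁ p * K₁ q = ∑ d : Fin 5, ∑ e : Fin 5, ∑ f : Fin 5, y d * y e * y f * (U₁ p d * W₁ q e f) := expand U₁ W₁ p q
  have eP2 : P₂ p * K₂ q = ∑ d : Fin 5, ∑ e : Fin 5, ∑ f : Fin 5, y d * y e * y f * (U₂ p d * W₂ q e f) := expand U₂ W₂ p q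
  have eP3 : P₁ q * K₁ p = ∑ d : Fin 5, ∑ e : Fin 5, ∑ f : Fin 5, y d * y e * y f * (U₁ q d * W₁ p e f) := expand U₁ W₁ q p
  have eP4 : P₂ q * K₂ p = ∑ d : Fin 5, ∑ e : Fin 5, ∑ f : Fin 5, y d * y e * y f * (U₂ q d * W₂ p e f) := expand U₂ W₂ q p
  rw [eP1, eP2, eP3, eP4]
  rw [← sub_eq_zero, ← Finset.sum_add_distrib, ← Finset.sum_add_distrib, ← Finset.sum_sub_distrib]
  rw [← h]
  refine Finset.sum_congr rfl fun d _ => ?_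
  rw [← Finset.sum_add_distrib, ← Finset.sum_add_distrib, ← Finset.sum_sub_distrib]
  refine Finset.sum_congr rfl fun e _ => ?_
  rw [← Finset.sum_add_distrib, ← Finset.sum_add_distrib, ← Finset.sum_sub_distrib]
  refine Finset.sum_congr rfl fun f _ => ?_
  ring

/-- **Parallel symmetric pencils are proportional.**  If `U₁ y ∥ U₂ y` for every vector `y` (all `2 × 2` minors of `[U₁y | U₂y]`
vanish) and `U₁, U₂` are symmetric, then `U₁ ⊗ U₂` is exchange-symmetric, i.e. `U₁` and `U₂` are proportional: so for independent
`U₁, U₂` some minor `M_{ac}(y)` is not identically zero (the start of LEMMA K).  Proof: the antisymmetrised tensor transforms under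
`S₄` by a character that is `+1` on `(12)` and `−1` on `(24)` — impossible unless it vanishes. [folklore] -/
theorem proportional_of_parallel (U₁ U₂ : Fin 5 → Fin 5 → ℂ) (hU1 : ∀ a b : Fin 5, U₁ a b = U₁ b a)
    (hU2 : ∀ a b : Fin 5, U₂ a b = U₂ b a)
    (h : ∀ (y : Fin 5 → ℂ) (a c : Fin 5),
      (∑ d : Fin 5, U₁ a d * y d) * (∑ d : Fin 5, U₂ c d * y d) = (∑ d : Fin 5, U₁ c d * y d) * (∑ d : Fin 5, U₂ a d * y d))
    (a b c d : Fin 5) : U₁ a b * U₂ c d = U₁ c d * U₂ a b := by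
  classical
  -- evaluation of the linear forms at basis vectors and at sums of two basis vectors
  have ev1 : ∀ (U : Fin 5 → Fin 5 → ℂ) (x b : Fin 5), (∑ d : Fin 5, U x d * (Pi.single b (1 : ℂ) : Fin 5 → ℂ) d) = U x b := by
    intro U x b
    simp [Pi.single_apply]
  have ev2 : ∀ (U : Fin 5 → Fin 5 → ℂ) (x b d : Fin 5),
      (∑ e : Fin 5, U x e * ((Pi.single b (1 : ℂ) : Fin 5 → ℂ) e + (Pi.single d (1 : ℂ) : Fin 5 → ℂ) e))
        = U x b + U x d := by
    intro U x b d
    simp [Pi.single_apply, mul_add, Finset.sum_add_distrib]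
  -- polarised hypothesis: T a b c d = - T a d c b for the antisymmetrised tensor T
  have anti : ∀ a b c d : Fin 5,
      U₁ a b * U₂ c d + U₁ a d * U₂ c b = U₁ c b * U₂ a d + U₁ c d * U₂ a b := by
    intro a b c d
    have p1 := h (Pi.single b 1) a c
    rw [ev1, ev1, ev1, ev1] at p1
    by_cases hbd : b = d
    · subst hbd
      linear_combination 2 * p1
    · have p2 := h (fun e => (Pi.single b (1 : ℂ) : Fin 5 → ℂ) e + (Pi.single d (1 : ℂ) : Fin 5 → ℂ) e) a c
      have p3 := h (Pi.single d 1) a c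
      rw [ev2, ev2, ev2, ev2] at p2
      rw [ev1, ev1, ev1, ev1] at p3
      linear_combination p2 - p1 - p3
  -- the S₄-character chain (24)(12)(24)(12)(24) = (12):  T(abcd) = −T(adcb) = −T(dacb) = T(dbca) = T(bdca) = −T(bacd) = −T(abcd)
  have c1 := anti a b c d
  have c2 := anti d a c b
  have c3 := anti b d c a
  rw [← hU1 a d, ← hU2 a d, hU1 d b, hU2 d b] at c2
  rw [hU1 b a, ← hU2 a b] at c3
  linear_combination (c1 - c2 + c3) / 2

end LaplaceFiveStar

end Summit.ValiantsHypothesis.ValiantsHypothesis.Theorems.RigidityForcesSymmetryRankRigidMinimalRepr
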